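import Mathlib.Algebra.BigOperators.Ring.Finset
import Literature.Topology.FourManifolds.LeeRasmussen
import Literature.Topology.FourManifolds.LeeRasmussenProofs
import Literature.Topology.FourManifolds.KhComplexQDegreeProofs
import Literature.Topology.FourManifolds.TorusKnotGauss
import HarnessLib

/-!
# Lee homology of the torus diagram in degree zero: `s = (p - 1)(q - 1)`

This file (topic `Topology/FourManifolds`, companion of `TorusKnotGauss`, `LeeRasmussen` and
`Rasmussen`) computes Rasmussen's invariant of the standard Gauss diagram `torusGauss p q` of
the torus knot `T(p, q)` (`p ≥ 2`, `q ≥ 1`, `gcd(p, q) = 1`) directly from the definitions of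
the prelude `LeeRasmussen` (Lee's complex `khovanovD ℚ 0 1`, the filtration `qMin`,
`classDegree`, `leeSMax`, `rasmussenInvariant = s_max - 1`):

* `TorusGauss.rasmussenInvariant_torusGauss` :
  `(torusGauss p q).rasmussenInvariant = (p - 1) (q - 1)`,

the combinatorial heart of `Rasmussen.hasRasmussenInvariant_torusKnot` (Rasmussen (2010),
Thm. 4: for a positive diagram with `n` crossings whose oriented resolution has `k` circles,
`s = -k + n + 1`; here `n = q (p - 1)`, `k = p`).

## The argument (Rasmussen (2010), §5.2, made elementary for this diagram)

All chords are positive, so `n₋ = 0`, the oriented resolution is the all-`0` state and sits in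
homological degree `0`, and there is nothing in degree `-1` (`isEmpty_degStates_neg_one`):
degree-`0` Lee homology classes are just cycles (`mk_eq_zero_iff`). By `TorusKnotGauss` the
circles of the oriented resolution are the `p` levels (`circleEquiv`), so degree-`0` enhanced
states are labellings `φ : Fin p → Bool` of the levels by `{1 ↔ false, X ↔ true}`
(`degZeroEquiv`), of quantum degree `#1 - #X + n` (`qDegree_stateOfFun`). Every degree-`1`
state is a one-chord flip at a chord `(β, c)`, which merges the levels `c`, `c + 1`
(`exists_eq_degOne`), and the matrix of Lee's `d₀` (`X² = 1`) in these coordinates is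
(`incidence_stateOfFun_stateOne`, `leeD_degOne_false`, `leeD_degOne_true`)
`(d₀ v)(β, c; λ, 1) = v(λ; 1, 1) + v(λ; X, X)`, `(d₀ v)(β, c; λ, X) = v(λ; X, 1) + v(λ; 1, X)`.
Hence a cycle satisfies the *flip relations* `v(φ) = -v(flip_{c,c+1} φ)` (`ker_flipAt`), and:

* (upper bound) a nonzero cycle does not vanish at some labelling with at most one `1`
  (descent `exists_nF_le_one`), whose filtration degree is `≤ n - p + 2`;
* (lower bound) the explicit vector `v₀(φ) = ε_odd(φ) ε_odd(X⋯X) - ε_even(φ) ε_even(X⋯X)`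
  (a normalised difference of Lee's canonical generators in the basis `{1, X}`) is a nonzero
  cycle vanishing on the all-`X` labelling, hence of filtration degree `≥ n - p + 2`.

So `s_max = n - p + 2` (`leeSMax_torusGauss`) and `s = s_max - 1 = (p - 1)(q - 1)`.

## Sources

* J. Rasmussen, *Khovanov homology and the slice genus*, Invent. Math. 182 (2010) 419–447,
  §2.1 (Lee's algebra `1·1 = X·X = 1`, `1·X = X`), §5.2 (positive knots: `s_min = q(𝔰_o) =
  -k + n`, `s = -k + n + 1`), Prop. 3.3 (`s_max = s_min + 2`), Thm. 4, Cor. 1.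
* O. Viro, *Khovanov homology, its definitions and ramifications*, Fund. Math. 184 (2004),
  §5.2 (incidence numbers of enhanced states; the model of `KhComplex`).
* Mathlib: `Matrix.toLin'_apply`, `Fintype.sum_eq_add`, `Equiv.sum_comp`,
  `SimpleGraph.ConnectedComponent.lift`, `Submodule.Quotient`, `Finset.mul_prod_erase`.
  Tree: `GaussDiagram.EnhancedState.ext'` (`LeeRasmussenProofs`),
  `GaussDiagram.EnhancedState.label_eq_of_reachable` (`KhComplexQDegreeProofs`).

## Design choices

* Hypotheses `hp : 2 ≤ p`, `hq : 1 ≤ q`, `hpq : p.Coprime q` are threaded explicitly (the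
  diagram `torusGauss p q` itself is total). Everything is phrased for the concrete index
  `0 + 1` of `leeCycles = ker (khovanovD ℚ 0 1 0 (0 + 1))`, so no casts along `0 + 1 = 1` occur.
* The proof does not use Lee's theorem (`finrank_leeHomologyZero_eq_two`) nor
  `leeSMax_eq_leeSMin_add_two` (named facts of `LeeRasmussen`): for this diagram the two
  bounds are obtained by hand, so the result is unconditional. No new named facts (D-0026).
* Not here: the realisation of `torusGauss p q` as the diagram of a regular projection of
  `torusKnot p q` (companion file), and the knot-level statement (`Rasmussen`).
-/

namespace Literature.Topology.FourManifolds

namespace TorusGauss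

open GaussDiagram

section Lee

variable (p q : ℕ)

/-- Local notation for this section: `𝕋` is the torus diagram `torusGauss p q`. -/
local notation "𝕋" => torusGauss p q

/-! ## Levels as elements of `Fin p`; one marked point on each level -/

variable {p q} in
/-- A marked point whose leaving arc has level `ℓ < p`: the last point of the first (odd) block
for `ℓ = 0`, the point at offset `ℓ - 1` of the zeroth (even) block otherwise. [folklore] -/
def lvlPos (hp : 2 ≤ p) (hq : 1 ≤ q) (ℓ : Fin p) : Fin (2 * (q * (p - 1))) :=
  if h : ℓ.val = 0 then pos p q (oblk ⟨0, hq⟩) ⟨p - 2, by omega⟩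
  else pos p q (ublk ⟨0, hq⟩) ⟨ℓ.val - 1, by have := ℓ.isLt; omega⟩

variable {p q} in
/-- The arc leaving `lvlPos ℓ` has level `ℓ`. [folklore] -/
@[simp]
theorem lvl_lvlPos (hp : 2 ≤ p) (hq : 1 ≤ q) (ℓ : Fin p) : lvl p (lvlPos hp hq ℓ).val = ℓ := by
  unfold lvlPos
  split_ifs with h
  · rw [lvl_pos_oblk]; simp only; omega
  · rw [lvl_pos_ublk]; simp only; omega

variable {p q} in
/-- `q (p - 1) ≥ 1` for `p ≥ 2`, `q ≥ 1`. [folklore] -/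
theorem n_pos (hp : 2 ≤ p) (hq : 1 ≤ q) : 0 < q * (p - 1) := Nat.mul_pos hq (by omega)

/-- The level of an arc, as an element of `Fin p`. [folklore] -/
def alvl (hp : 2 ≤ p) (hq : 1 ≤ q) (a : (𝕋).Arc) : Fin p :=
  ⟨lvl p a.val, lt_of_le_of_lt (lvl_le (⟨a.val, arc_val_lt p q (n_pos hp hq) a⟩ : Fin _))
    (by omega)⟩

/-- The value of `alvl a` is `lvl a`. [folklore] -/
@[simp]
theorem alvl_val (hp : 2 ≤ p) (hq : 1 ≤ q) (a : (𝕋).Arc) : (alvl p q hp hq a).val = lvl p a.val :=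
  rfl

/-- The arc leaving `lvlPos ℓ` has level `ℓ` (in `Fin p`). [folklore] -/
@[simp]
theorem alvl_arcOut_lvlPos (hp : 2 ≤ p) (hq : 1 ≤ q) (ℓ : Fin p) :
    alvl p q hp hq ((𝕋).arcOut (lvlPos hp hq ℓ)) = ℓ :=
  Fin.ext (lvl_lvlPos hp hq ℓ)

/-! ## The circles of the oriented resolution are the `p` levels -/

/-- **The oriented resolution of the torus diagram has `p` circles, indexed by the level**:
the bijection `StateCircle (all 0) ≃ Fin p` sending the circle of an arc to its level
(well defined and injective by `circleOf_seifert_eq_iff`, surjective by `lvlPos`).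
Rasmussen (2010), §5.2 (`k` circles of the oriented resolution; here `k = p`). [folklore] -/
def circleEquiv (hp : 2 ≤ p) (hq : 1 ≤ q) (hpq : p.Coprime q) :
    (𝕋).StateCircle (fun _ ↦ false) ≃ Fin p where
  toFun := SimpleGraph.ConnectedComponent.lift (fun a ↦ alvl p q hp hq a)
    (fun _ _ w _ ↦ Fin.ext (lvl_eq_of_reachable_seifert p q ⟨w⟩))
  invFun ℓ := (𝕋).circleOf (fun _ ↦ false) ((𝕋).arcOut (lvlPos hp hq ℓ))
  left_inv C := by
    induction C using SimpleGraph.ConnectedComponent.ind with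
    | h a =>
      dsimp only
      rw [SimpleGraph.ConnectedComponent.lift_mk, GaussDiagram.circleOf,
        SimpleGraph.ConnectedComponent.eq, reachable_seifert_iff p q hpq (n_pos hp hq)]
      exact lvl_lvlPos hp hq _
  right_inv ℓ := by
    dsimp only
    rw [GaussDiagram.circleOf, SimpleGraph.ConnectedComponent.lift_mk]
    exact alvl_arcOut_lvlPos p q hp hq ℓ

/-- The level bijection sends the circle of an arc to its level. [folklore] -/
@[simp]
theorem circleEquiv_circleOf (hp : 2 ≤ p) (hq : 1 ≤ q) (hpq : p.Coprime q) (a : (𝕋).Arc) :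
    circleEquiv p q hp hq hpq ((𝕋).circleOf (fun _ ↦ false) a) = alvl p q hp hq a :=
  rfl

/-! ## Enhanced states of homological degree `0` = labellings of the levels -/

/-- The enhanced state on the oriented (all-`0`) resolution whose circle of level `ℓ` is
labelled `φ ℓ` (`false ↔ 1`, `true ↔ X`). [folklore] -/
def stateOfFun (hp : 2 ≤ p) (hq : 1 ≤ q) (φ : Fin p → Bool) : (𝕋).EnhancedState where
  state _ := false
  label a := φ (alvl p q hp hq a)
  label_eq a b hab := by
    rcases lvl_eq_or_of_adj p q (fun _ ↦ false) hab with h | ⟨j, hj, -⟩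
    · exact congrArg φ (Fin.ext h)
    · exact absurd hj (by simp)

/-- The state of `stateOfFun φ` is the oriented resolution. [folklore] -/
@[simp] theorem stateOfFun_state (hp : 2 ≤ p) (hq : 1 ≤ q) (φ : Fin p → Bool) :
    (stateOfFun p q hp hq φ).state = fun _ ↦ false := rfl

/-- The label of an arc in `stateOfFun φ` is `φ` of its level. [folklore] -/
@[simp] theorem stateOfFun_label (hp : 2 ≤ p) (hq : 1 ≤ q) (φ : Fin p → Bool) (a : (𝕋).Arc) :
    (stateOfFun p q hp hq φ).label a = φ (alvl p q hp hq a) := rfl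

/-- The all-`0` state has weight `0`. [folklore] -/
@[simp] theorem weight_seifert : State.weight (G := 𝕋) (fun _ ↦ false) = 0 := by
  rw [GaussDiagram.State.weight, Finset.card_eq_zero, Finset.filter_eq_empty_iff]
  simp

/-- Labellings of the oriented resolution have homological degree `0` (`n₋ = 0`). [folklore] -/
theorem homDegree_stateOfFun (hp : 2 ≤ p) (hq : 1 ≤ q) (φ : Fin p → Bool) :
    homDegree (stateOfFun p q hp hq φ) = 0 := by
  rw [GaussDiagram.homDegree, stateOfFun_state, weight_seifert, nMinus_eq]; simp

/-- A degree-`0` enhanced state lives on the oriented resolution: its weight is `n₋ = 0`.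
Rasmussen (2010), §5.2. [cite: Rasmussen2010, §5.2] -/
theorem state_eq_of_homDegree_eq_zero {s : (𝕋).EnhancedState} (h : homDegree s = 0) :
    s.state = fun _ ↦ false := by
  simp only [GaussDiagram.homDegree, nMinus_eq, Nat.cast_zero, sub_zero, Nat.cast_eq_zero,
    GaussDiagram.State.weight, Finset.card_eq_zero, Finset.filter_eq_empty_iff,
    Finset.mem_univ, true_implies] at h
  funext i
  simpa using h (x := i)

/-- In a degree-`0` enhanced state the label of an arc is the label of the marked arc of its
level (labels are constant on the Seifert circles = levels). [folklore] -/
theorem label_eq_label_lvlPos (hp : 2 ≤ p) (hq : 1 ≤ q) (hpq : p.Coprime q)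
    {s : (𝕋).EnhancedState} (h : homDegree s = 0) (a : (𝕋).Arc) :
    s.label a = s.label ((𝕋).arcOut (lvlPos hp hq (alvl p q hp hq a))) := by
  apply s.label_eq_of_reachable
  rw [state_eq_of_homDegree_eq_zero p q h, reachable_seifert_iff p q hpq (n_pos hp hq)]
  change lvl p a.val = lvl p (lvlPos hp hq (alvl p q hp hq a)).val
  rw [lvl_lvlPos, alvl_val]

/-- **Degree-`0` enhanced states of the torus diagram are the labellings of the `p` levels.**
[folklore] -/
def degZeroEquiv (hp : 2 ≤ p) (hq : 1 ≤ q) (hpq : p.Coprime q) :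
    (Fin p → Bool) ≃ (𝕋).degStates 0 where
  toFun φ := ⟨stateOfFun p q hp hq φ, homDegree_stateOfFun p q hp hq φ⟩
  invFun s ℓ := s.1.label ((𝕋).arcOut (lvlPos hp hq ℓ))
  left_inv φ := by
    funext ℓ
    simp
  right_inv s := by
    apply Subtype.ext
    apply GaussDiagram.EnhancedState.ext'
    · exact (state_eq_of_homDegree_eq_zero p q s.2).symm
    · funext a
      exact (label_eq_label_lvlPos p q hp hq hpq s.2 a).symm

/-- The enhanced state underlying `degZeroEquiv φ` is `stateOfFun φ`. [folklore] -/
@[simp] theorem degZeroEquiv_apply_val (hp : 2 ≤ p) (hq : 1 ≤ q) (hpq : p.Coprime q)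
    (φ : Fin p → Bool) : (degZeroEquiv p q hp hq hpq φ).1 = stateOfFun p q hp hq φ := rfl

/-! ## Quantum degrees in degree `0` -/

variable {p} in
/-- The number of levels labelled `1` (`false`). [folklore] -/
def nF (φ : Fin p → Bool) : ℕ := (Finset.univ.filter fun ℓ ↦ φ ℓ = false).card

variable {p} in
/-- The number of levels labelled `X` (`true`). [folklore] -/
def nT (φ : Fin p → Bool) : ℕ := (Finset.univ.filter fun ℓ ↦ φ ℓ = true).card

variable {p} in
/-- `#1 + #X = p`. [folklore] -/
theorem nF_add_nT (φ : Fin p → Bool) : nF φ + nT φ = p := by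
  rw [nF, nT]
  have h := Finset.card_filter_add_card_filter_not (s := (Finset.univ : Finset (Fin p)))
    (fun ℓ ↦ φ ℓ = false)
  simp only [Finset.card_univ, Fintype.card_fin] at h
  convert h using 3
  ext ℓ
  simp

/-- The number of circles of the oriented resolution carrying the label `b` in the labelling
`φ` is the number of levels `ℓ` with `φ ℓ = b`. [folklore] -/
theorem card_circles_label_eq (hp : 2 ≤ p) (hq : 1 ≤ q) (hpq : p.Coprime q) (φ : Fin p → Bool)
    (b : Bool) :
    (Finset.univ.filter fun C : (𝕋).StateCircle (fun _ ↦ false) ↦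
        ∃ a, (𝕋).circleOf (fun _ ↦ false) a = C ∧ φ (alvl p q hp hq a) = b).card =
      (Finset.univ.filter fun ℓ : Fin p ↦ φ ℓ = b).card := by
  rw [← Fintype.card_subtype, ← Fintype.card_subtype]
  refine Fintype.card_congr (Equiv.subtypeEquiv (circleEquiv p q hp hq hpq) fun C ↦ ?_)
  induction C using SimpleGraph.ConnectedComponent.ind with
  | h a =>
    change (∃ a', (𝕋).circleOf (fun _ ↦ false) a' = (𝕋).circleOf (fun _ ↦ false) a ∧ _) ↔
      φ (circleEquiv p q hp hq hpq ((𝕋).circleOf (fun _ ↦ false) a)) = b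
    rw [circleEquiv_circleOf]
    constructor
    · rintro ⟨a', ha', hb⟩
      rw [circleOf_seifert_eq_iff p q hpq (n_pos hp hq)] at ha'
      rw [← hb]
      exact congrArg φ (Fin.ext ha'.symm)
    · exact fun hb ↦ ⟨a, rfl, hb⟩

/-- **The quantum degree of a labelling of the oriented resolution**:
`q = #1 - #X + n` (weight `0`, `n₊ = n`, `n₋ = 0`). Rasmussen (2010), §5.2
(`q(𝔰) = p(𝔰) + gr(𝔰) + n₊ - n₋`). [cite: Rasmussen2010, §5.2] -/
theorem qDegree_stateOfFun (hp : 2 ≤ p) (hq : 1 ≤ q) (hpq : p.Coprime q) (φ : Fin p → Bool) :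
    qDegree (stateOfFun p q hp hq φ) = (nF φ : ℤ) - nT φ + ((q * (p - 1) : ℕ) : ℤ) := by
  rw [GaussDiagram.qDegree, stateOfFun_state, weight_seifert, nPlus_eq, nMinus_eq]
  simp only [stateOfFun_label]
  rw [card_circles_label_eq p q hp hq hpq φ false, card_circles_label_eq p q hp hq hpq φ true]
  simp [nF, nT]


/-! ## Enhanced states of homological degree `1` -/

/-- The two levels `c`, `c + 1` joined by a chord of offset `c`, as elements of `Fin p`.
[folklore] -/
def lv0 (c : Fin (p - 1)) : Fin p := ⟨c, by omega⟩

/-- See `lv0`. [folklore] -/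
def lv1 (c : Fin (p - 1)) : Fin p := ⟨c + 1, by omega⟩

/-- The value of `lv0 c` is `c`. [folklore] -/
@[simp] theorem lv0_val (c : Fin (p - 1)) : (lv0 p c).val = c := rfl

/-- The value of `lv1 c` is `c + 1`. [folklore] -/
@[simp] theorem lv1_val (c : Fin (p - 1)) : (lv1 p c).val = c + 1 := rfl

/-- The two levels at a chord are distinct. [folklore] -/
theorem lv0_ne_lv1 (c : Fin (p - 1)) : lv0 p c ≠ lv1 p c := fun h ↦ by
  have := congrArg Fin.val h; simp at this

/-- The enhanced state on the resolution with the single chord `(β, c)` flipped to `1`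
(weight `1`): the merged circle (levels `c` and `c + 1`, `circleOf_update_eq_iff`) is labelled
`m`, the circle of every other level `ℓ` is labelled `λ ℓ`. [folklore] -/
def stateOne (hp : 2 ≤ p) (hq : 1 ≤ q) (β : Fin q) (c : Fin (p - 1)) (lam : Fin p → Bool)
    (m : Bool) : (𝕋).EnhancedState where
  state := Function.update (fun _ ↦ false) (chord p q β c) true
  label a := if lvl p a.val = c ∨ lvl p a.val = c + 1 then m else lam (alvl p q hp hq a)
  label_eq a b hab := by
    rcases lvl_eq_or_of_adj p q _ hab with h | ⟨j, hj, ha, hb⟩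
    · have e : alvl p q hp hq a = alvl p q hp hq b := Fin.ext h
      simp only [h, e]
    · have hjc : j = chord p q β c := by
        by_contra hne
        rw [Function.update_of_ne hne] at hj
        exact Bool.false_ne_true hj
      subst hjc
      rw [coff_chord] at ha hb
      rw [if_pos ha, if_pos hb]

/-- The state of `stateOne β c λ m` is the one-chord flip at `(β, c)`. [folklore] -/
@[simp] theorem stateOne_state (hp : 2 ≤ p) (hq : 1 ≤ q) (β : Fin q) (c : Fin (p - 1))
    (lam : Fin p → Bool) (m : Bool) :
    (stateOne p q hp hq β c lam m).state = Function.update (fun _ ↦ false) (chord p q β c) true :=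
  rfl

/-- The labels of `stateOne β c λ m`. [folklore] -/
theorem stateOne_label (hp : 2 ≤ p) (hq : 1 ≤ q) (β : Fin q) (c : Fin (p - 1))
    (lam : Fin p → Bool) (m : Bool) (a : (𝕋).Arc) :
    (stateOne p q hp hq β c lam m).label a =
      if lvl p a.val = c ∨ lvl p a.val = c + 1 then m else lam (alvl p q hp hq a) := rfl

/-- Flipping one chord of the oriented resolution gives weight `1`. [folklore] -/
theorem weight_update (i : Fin (𝕋).n) :
    State.weight (G := 𝕋) (Function.update (fun _ ↦ false) i true) = 1 := by
  rw [State.weight_update rfl, weight_seifert]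

/-- The states `stateOne` have homological degree `1`. [folklore] -/
theorem homDegree_stateOne (hp : 2 ≤ p) (hq : 1 ≤ q) (β : Fin q) (c : Fin (p - 1))
    (lam : Fin p → Bool) (m : Bool) : homDegree (stateOne p q hp hq β c lam m) = 0 + 1 := by
  rw [GaussDiagram.homDegree, stateOne_state, weight_update, nMinus_eq]; simp

/-- `stateOne` as an element of `degStates (0 + 1)`, the target of Lee's `d₀`. [folklore] -/
def degOne (hp : 2 ≤ p) (hq : 1 ≤ q) (β : Fin q) (c : Fin (p - 1)) (lam : Fin p → Bool)
    (m : Bool) : (𝕋).degStates (0 + 1) :=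
  ⟨stateOne p q hp hq β c lam m, homDegree_stateOne p q hp hq β c lam m⟩

/-- The flipped chord of a one-flip state is determined by the state. [folklore] -/
theorem eq_of_update_eq {i j : Fin (𝕋).n}
    (h : Function.update (fun _ ↦ false) i true =
      Function.update (fun _ : Fin (𝕋).n ↦ false) j true) :
    i = j := by
  by_contra hne
  have := congrFun h i
  rw [Function.update_self, Function.update_of_ne hne] at this
  exact Bool.false_ne_true this.symm

/-- **Every edge out of the oriented resolution is a merge** of the two (distinct) Seifert
circles `c + 1 ∋ arcIn (overPos)` and `c ∋ arcOut (overPos)` at the chord `(β, c)`.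
Rasmussen (2010), §5.2; Khovanov (2000), §4.2. [folklore] -/
theorem isMergeAt_chord (hp : 2 ≤ p) (hq : 1 ≤ q) (hpq : p.Coprime q) (β : Fin q)
    (c : Fin (p - 1)) : (𝕋).IsMergeAt (fun _ ↦ false) (chord p q β c) := by
  refine ⟨rfl, fun h ↦ ?_⟩
  rw [circleOf_seifert_eq_iff p q hpq (n_pos hp hq), overPos_chord] at h
  change lvl p ((𝕋).predPt (oPos p q β c)).val = lvl p (oPos p q β c).val at h
  rw [lvl_predPt_oPos, lvl_oPos] at h
  omega

/-- After flipping the chord `(β, c)`, an arc lies off the merged circle (the circle of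
`arcIn (overPos)`) iff its level is neither `c` nor `c + 1`. [folklore] -/
theorem circleOf_update_ne_iff (hp : 2 ≤ p) (hq : 1 ≤ q) (hpq : p.Coprime q) (β : Fin q)
    (c : Fin (p - 1)) (a : (𝕋).Arc) :
    (𝕋).circleOf (Function.update (fun _ ↦ false) (chord p q β c) true) a ≠
        (𝕋).circleOf (Function.update (fun _ ↦ false) (chord p q β c) true)
          ((𝕋).arcIn ((𝕋).overPos (chord p q β c))) ↔
      ¬ (lvl p a.val = c ∨ lvl p a.val = c + 1) := by
  rw [Ne, circleOf_update_eq_iff p q hpq (n_pos hp hq), overPos_chord, not_iff_not]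
  have hA : lvl p ((𝕋).arcIn (oPos p q β c)).val = c + 1 := lvl_predPt_oPos β c
  rw [hA]
  constructor
  · rintro (h | ⟨h, -⟩)
    · exact Or.inr h
    · exact h
  · exact fun h ↦ Or.inr ⟨h, Or.inr rfl⟩

/-- The Koszul sign of an edge out of the oriented (all-`0`) resolution is `+1`. [folklore] -/
@[simp] theorem edgeSign_seifert (i : Fin (𝕋).n) :
    edgeSign (G := 𝕋) (fun _ ↦ false) i = 1 := by
  rw [GaussDiagram.edgeSign, Finset.filter_false_of_mem fun j _ ↦ by simp, Finset.card_empty,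
    pow_zero]

/-- Agreement of two level labellings away from the levels `c`, `c + 1`. [folklore] -/
def Agree (c : Fin (p - 1)) (lam φ : Fin p → Bool) : Prop :=
  ∀ ℓ : Fin p, ℓ.val ≠ c → ℓ.val ≠ c + 1 → lam ℓ = φ ℓ

/-- `Agree` is decidable (a finite conjunction). [folklore] -/
instance (c : Fin (p - 1)) (lam φ : Fin p → Bool) : Decidable (Agree p c lam φ) :=
  inferInstanceAs (Decidable (∀ ℓ : Fin p, ℓ.val ≠ c → ℓ.val ≠ c + 1 → lam ℓ = φ ℓ))

/-- **The incidence numbers of Lee's `d₀` on the torus diagram.** The matrix entry of `d₀`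
from the labelling `φ` of the oriented resolution to the one-flip state `(β, c; λ, m)` is the
multiplication coefficient `⟨φ(c+1) · φ(c), m⟩` of Lee's algebra `ℚ[X]/(X² - 1)` if `λ` agrees
with `φ` off the merged circle, and `0` otherwise (merge edge, Koszul sign `+1`).
Viro (2004), §5.2; Rasmussen (2010), §2.1, §5.2. [cite: Viro2004, §5.2] -/
theorem incidence_stateOfFun_stateOne (hp : 2 ≤ p) (hq : 1 ≤ q) (hpq : p.Coprime q)
    (φ : Fin p → Bool) (β : Fin q) (c : Fin (p - 1)) (lam : Fin p → Bool) (m : Bool) :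
    (𝕋).incidence ℚ 0 1 (stateOfFun p q hp hq φ) (stateOne p q hp hq β c lam m) =
      if Agree p c lam φ then mergeCoeff ℚ 0 1 (φ (lv1 p c)) (φ (lv0 p c)) m else 0 := by
  classical
  have hi : ∃ i, (stateOfFun p q hp hq φ).state i = false ∧
      (stateOne p q hp hq β c lam m).state =
        Function.update (stateOfFun p q hp hq φ).state i true := ⟨chord p q β c, rfl, rfl⟩
  have hci : Classical.choose hi = chord p q β c :=
    (eq_of_update_eq p q (Classical.choose_spec hi).2).symm
  unfold GaussDiagram.incidence
  rw [dif_pos hi]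
  dsimp only
  rw [hci, stateOfFun_state, if_pos (isMergeAt_chord p q hp hq hpq β c)]
  -- the condition "labels agree off the merged circle" is `Agree`
  have hcond : (∀ a', (𝕋).circleOf (stateOne p q hp hq β c lam m).state a' ≠
      (𝕋).circleOf (stateOne p q hp hq β c lam m).state ((𝕋).arcIn ((𝕋).overPos (chord p q β c))) →
      (stateOne p q hp hq β c lam m).label a' = (stateOfFun p q hp hq φ).label a') ↔
      Agree p c lam φ := by
    simp only [stateOne_state, circleOf_update_ne_iff p q hp hq hpq, stateOne_label,
      stateOfFun_label]
    constructor
    · intro h ℓ h0 h1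
      have h' := h ((𝕋).arcOut (lvlPos hp hq ℓ))
      simp only [arcOut_val, lvl_lvlPos, alvl_arcOut_lvlPos] at h'
      have hM : ¬ ((ℓ : ℕ) = c ∨ (ℓ : ℕ) = c + 1) := by omega
      simpa [hM] using h' hM
    · intro h a' ha'
      rw [if_neg ha']
      exact h _ (fun h0 ↦ ha' (Or.inl h0)) (fun h1 ↦ ha' (Or.inr h1))
  by_cases hA : Agree p c lam φ
  · rw [if_pos (hcond.2 hA), if_pos hA, edgeSign_seifert, Int.cast_one, one_mul, overPos_chord]
    have h1 : alvl p q hp hq ((𝕋).arcIn (oPos p q β c)) = lv1 p c := Fin.ext (lvl_predPt_oPos β c)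
    have h0 : alvl p q hp hq ((𝕋).arcOut (oPos p q β c)) = lv0 p c := Fin.ext (lvl_oPos β c)
    have hm : (stateOne p q hp hq β c lam m).label ((𝕋).arcIn (oPos p q β c)) = m := by
      rw [stateOne_label, if_pos]
      exact Or.inr (lvl_predPt_oPos β c)
    rw [stateOfFun_label, stateOfFun_label, h1, h0, hm]
  · rw [if_neg (fun h ↦ hA (hcond.1 h)), if_neg hA]

/-! ## Lee's differential `d₀` in the level coordinates -/

/-- Matrix form of the differential: `(d₀ v)(s') = Σₛ ⟨d s, s'⟩ v(s)`. [folklore] -/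
theorem leeD_apply (v : (𝕋).degStates 0 → ℚ) (s' : (𝕋).degStates (0 + 1)) :
    (𝕋).khovanovD ℚ 0 1 0 (0 + 1) v s' = ∑ s, (𝕋).incidence ℚ 0 1 s.1 s'.1 * v s := by
  rw [GaussDiagram.khovanovD, Matrix.toLin'_apply]
  rfl

/-- Sums over degree-`0` states are sums over level labellings. [folklore] -/
theorem sum_degStates_zero (hp : 2 ≤ p) (hq : 1 ≤ q) (hpq : p.Coprime q)
    (f : (𝕋).degStates 0 → ℚ) : ∑ s, f s = ∑ φ : Fin p → Bool, f (degZeroEquiv p q hp hq hpq φ) :=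
  (Equiv.sum_comp (degZeroEquiv p q hp hq hpq) f).symm

variable {p} in
/-- Overwrite a level labelling at the levels `c ↦ x` and `c + 1 ↦ y`. [folklore] -/
def setAt (c : Fin (p - 1)) (φ : Fin p → Bool) (x y : Bool) : Fin p → Bool :=
  Function.update (Function.update φ (lv0 p c) x) (lv1 p c) y

variable {p} in
/-- The overwritten value at the level `c`. [folklore] -/
@[simp] theorem setAt_lv0 (c : Fin (p - 1)) (φ : Fin p → Bool) (x y : Bool) :
    setAt c φ x y (lv0 p c) = x := by
  rw [setAt, Function.update_of_ne (lv0_ne_lv1 p c), Function.update_self]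

variable {p} in
/-- The overwritten value at the level `c + 1`. [folklore] -/
@[simp] theorem setAt_lv1 (c : Fin (p - 1)) (φ : Fin p → Bool) (x y : Bool) :
    setAt c φ x y (lv1 p c) = y := by
  rw [setAt, Function.update_self]

variable {p} in
/-- Overwriting does not change the other levels. [folklore] -/
theorem setAt_of_ne (c : Fin (p - 1)) (φ : Fin p → Bool) (x y : Bool) {ℓ : Fin p}
    (h0 : ℓ.val ≠ c) (h1 : ℓ.val ≠ c + 1) : setAt c φ x y ℓ = φ ℓ := by
  rw [setAt, Function.update_of_ne (fun h ↦ h1 (by rw [h]; rfl)),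
    Function.update_of_ne (fun h ↦ h0 (by rw [h]; rfl))]

variable {p} in
/-- A labelling is its own overwrite by its values at `c`, `c + 1`. [folklore] -/
theorem setAt_self (c : Fin (p - 1)) (φ : Fin p → Bool) :
    setAt c φ (φ (lv0 p c)) (φ (lv1 p c)) = φ := by
  funext ℓ
  by_cases h0 : ℓ = lv0 p c
  · subst h0; exact setAt_lv0 c φ _ _
  by_cases h1 : ℓ = lv1 p c
  · subst h1; exact setAt_lv1 c φ _ _
  exact setAt_of_ne c φ _ _ (fun h ↦ h0 (Fin.ext h)) (fun h ↦ h1 (Fin.ext h))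

variable {p} in
/-- A labelling agreeing with `λ` off `{c, c+1}` is an overwrite of `λ`. [folklore] -/
theorem eq_setAt_of_agree {c : Fin (p - 1)} {lam φ : Fin p → Bool} (h : Agree p c lam φ) :
    φ = setAt c lam (φ (lv0 p c)) (φ (lv1 p c)) := by
  funext ℓ
  by_cases h0 : ℓ = lv0 p c
  · subst h0; exact (setAt_lv0 c lam _ _).symm
  by_cases h1 : ℓ = lv1 p c
  · subst h1; exact (setAt_lv1 c lam _ _).symm
  rw [setAt_of_ne c lam _ _ (fun h ↦ h0 (Fin.ext h)) (fun h ↦ h1 (Fin.ext h))]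
  exact (h ℓ (fun h ↦ h0 (Fin.ext h)) (fun h ↦ h1 (Fin.ext h))).symm

variable {p} in
/-- Overwrites of `λ` agree with `λ` off `{c, c+1}`. [folklore] -/
theorem agree_setAt (c : Fin (p - 1)) (lam : Fin p → Bool) (x y : Bool) :
    Agree p c lam (setAt c lam x y) :=
  fun _ h0 h1 ↦ (setAt_of_ne c lam x y h0 h1).symm

/-- Lee's multiplication into the label `1`: `⟨x · y, 1⟩ = [x = y]` (`1·1 = 1`, `X·X = 1`).
Rasmussen (2010), §2.1 (Lee's algebra). [cite: Rasmussen2010, §2.1] -/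
theorem mergeCoeff_lee_false (x y : Bool) :
    mergeCoeff ℚ 0 1 x y false = if x = y then 1 else 0 := by
  cases x <;> cases y <;> simp [GaussDiagram.mergeCoeff]

/-- Lee's multiplication into the label `X`: `⟨x · y, X⟩ = [x ≠ y]` (`1·X = X·1 = X`; the
coefficient `h` of `X` in `X·X` is `0`). Rasmussen (2010), §2.1. [cite: Rasmussen2010, §2.1] -/
theorem mergeCoeff_lee_true (x y : Bool) :
    mergeCoeff ℚ 0 1 x y true = if x = y then 0 else 1 := by
  cases x <;> cases y <;> simp [GaussDiagram.mergeCoeff]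

/-- **Lee's `d₀` into a merged circle labelled `1`**:
`(d₀ v)(β, c; λ, 1) = v(λ; 1, 1) + v(λ; X, X)`. Rasmussen (2010), §2.1, §5.2. [folklore] -/
theorem leeD_degOne_false (hp : 2 ≤ p) (hq : 1 ≤ q) (hpq : p.Coprime q)
    (v : (𝕋).degStates 0 → ℚ) (β : Fin q) (c : Fin (p - 1)) (lam : Fin p → Bool) :
    (𝕋).khovanovD ℚ 0 1 0 (0 + 1) v (degOne p q hp hq β c lam false) =
      v (degZeroEquiv p q hp hq hpq (setAt c lam false false)) +
        v (degZeroEquiv p q hp hq hpq (setAt c lam true true)) := by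
  rw [leeD_apply, sum_degStates_zero p q hp hq hpq]
  have hne : setAt c lam false false ≠ setAt c lam true true := fun h ↦ by
    have := congrFun h (lv0 p c); simp at this
  rw [Fintype.sum_eq_add (setAt c lam false false) (setAt c lam true true) hne]
  · simp only [degZeroEquiv_apply_val, degOne, incidence_stateOfFun_stateOne p q hp hq hpq,
      if_pos (agree_setAt c lam _ _), setAt_lv0, setAt_lv1, mergeCoeff_lee_false]
    simp
  · intro φ ⟨h1, h2⟩
    simp only [degZeroEquiv_apply_val, degOne, incidence_stateOfFun_stateOne p q hp hq hpq,
      mergeCoeff_lee_false]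
    by_cases hA : Agree p c lam φ
    · rw [if_pos hA]
      have hφ := eq_setAt_of_agree hA
      by_cases hxy : φ (lv1 p c) = φ (lv0 p c)
      · exfalso
        rw [hxy] at hφ
        cases h : φ (lv0 p c)
        · exact h1 (by rw [hφ, h])
        · exact h2 (by rw [hφ, h])
      · rw [if_neg hxy, zero_mul]
    · rw [if_neg hA, zero_mul]

/-- **Lee's `d₀` into a merged circle labelled `X`**:
`(d₀ v)(β, c; λ, X) = v(λ; X, 1) + v(λ; 1, X)` (values at the levels `c`, `c + 1`).
Rasmussen (2010), §2.1, §5.2. [folklore] -/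
theorem leeD_degOne_true (hp : 2 ≤ p) (hq : 1 ≤ q) (hpq : p.Coprime q)
    (v : (𝕋).degStates 0 → ℚ) (β : Fin q) (c : Fin (p - 1)) (lam : Fin p → Bool) :
    (𝕋).khovanovD ℚ 0 1 0 (0 + 1) v (degOne p q hp hq β c lam true) =
      v (degZeroEquiv p q hp hq hpq (setAt c lam true false)) +
        v (degZeroEquiv p q hp hq hpq (setAt c lam false true)) := by
  rw [leeD_apply, sum_degStates_zero p q hp hq hpq]
  have hne : setAt c lam true false ≠ setAt c lam false true := fun h ↦ by
    have := congrFun h (lv0 p c); simp at this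
  rw [Fintype.sum_eq_add (setAt c lam true false) (setAt c lam false true) hne]
  · simp only [degZeroEquiv_apply_val, degOne, incidence_stateOfFun_stateOne p q hp hq hpq,
      if_pos (agree_setAt c lam _ _), setAt_lv0, setAt_lv1, mergeCoeff_lee_true]
    simp
  · intro φ ⟨h1, h2⟩
    simp only [degZeroEquiv_apply_val, degOne, incidence_stateOfFun_stateOne p q hp hq hpq,
      mergeCoeff_lee_true]
    by_cases hA : Agree p c lam φ
    · rw [if_pos hA]
      have hφ := eq_setAt_of_agree hA
      by_cases hxy : φ (lv1 p c) = φ (lv0 p c)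
      · rw [if_pos hxy, zero_mul]
      · exfalso
        cases h : φ (lv0 p c)
        · have h' : φ (lv1 p c) = true := by simpa [h] using hxy
          rw [h, h'] at hφ
          exact h2 hφ
        · have h' : φ (lv1 p c) = false := by simpa [h] using hxy
          rw [h, h'] at hφ
          exact h1 hφ
    · rw [if_neg hA, zero_mul]


/-! ## The kernel of `d₀`: the flip relation -/

variable {p} in
/-- Overwriting twice at the same two levels. [folklore] -/
@[simp] theorem setAt_setAt (c : Fin (p - 1)) (φ : Fin p → Bool) (x y x' y' : Bool) :
    setAt c (setAt c φ x y) x' y' = setAt c φ x' y' := by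
  funext ℓ
  by_cases h0 : ℓ = lv0 p c
  · subst h0; simp
  by_cases h1 : ℓ = lv1 p c
  · subst h1; simp
  have h0' : ℓ.val ≠ c := fun h ↦ h0 (Fin.ext h)
  have h1' : ℓ.val ≠ c + 1 := fun h ↦ h1 (Fin.ext h)
  rw [setAt_of_ne c _ _ _ h0' h1', setAt_of_ne c _ _ _ h0' h1', setAt_of_ne c _ _ _ h0' h1']

variable {p} in
/-- The **flip** of a labelling at the two levels `c`, `c + 1` joined by a chord of offset `c`.
[folklore] -/
def flipAt (c : Fin (p - 1)) (φ : Fin p → Bool) : Fin p → Bool :=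
  setAt c φ (!φ (lv0 p c)) (!φ (lv1 p c))

/-- **The kernel relations of Lee's `d₀`.** If `d₀ v = 0` then
`v(φ; x, y) + v(φ; x̄, ȳ) = 0` for the two labellings overwritten at the levels `c`, `c + 1`
by `(x, y)` and by the complementary pair. Rasmussen (2010), §5.2 (the computation of
`Kh'⁰` of a positive diagram from its oriented resolution). [folklore] -/
theorem ker_setAt (hp : 2 ≤ p) (hq : 1 ≤ q) (hpq : p.Coprime q) (v : (𝕋).degStates 0 → ℚ)
    (hv : (𝕋).khovanovD ℚ 0 1 0 (0 + 1) v = 0) (c : Fin (p - 1)) (φ : Fin p → Bool)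
    (x y : Bool) :
    v (degZeroEquiv p q hp hq hpq (setAt c φ x y)) +
      v (degZeroEquiv p q hp hq hpq (setAt c φ (!x) (!y))) = 0 := by
  have hF := leeD_degOne_false p q hp hq hpq v ⟨0, by omega⟩ c φ
  have hT := leeD_degOne_true p q hp hq hpq v ⟨0, by omega⟩ c φ
  simp only [hv, Pi.zero_apply] at hF hT
  cases x <;> cases y
  · exact hF.symm
  · rw [add_comm]; exact hT.symm
  · exact hT.symm
  · rw [add_comm]; exact hF.symm

/-- The flip relation: `v(φ) = -v(flip_c φ)` on the kernel of `d₀`. [folklore] -/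
theorem ker_flipAt (hp : 2 ≤ p) (hq : 1 ≤ q) (hpq : p.Coprime q) (v : (𝕋).degStates 0 → ℚ)
    (hv : (𝕋).khovanovD ℚ 0 1 0 (0 + 1) v = 0) (c : Fin (p - 1)) (φ : Fin p → Bool) :
    v (degZeroEquiv p q hp hq hpq φ) + v (degZeroEquiv p q hp hq hpq (flipAt c φ)) = 0 := by
  have h := ker_setAt p q hp hq hpq v hv c φ (φ (lv0 p c)) (φ (lv1 p c))
  rwa [setAt_self] at h

/-! ## Upper bound: every nonzero cycle sees a labelling with at most one `1` -/

variable {p} in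
/-- The descent measure `Σ_{φ ℓ = 1} (ℓ + 1)` of a labelling. [folklore] -/
def meas (φ : Fin p → Bool) : ℕ := ∑ ℓ, if φ ℓ = false then ℓ.val + 1 else 0

variable {p} in
/-- A labelling with two circles labelled `1` has a circle labelled `1` at a level `≥ 1`.
[folklore] -/
theorem exists_false_pos {φ : Fin p → Bool} (h : 1 < nF φ) :
    ∃ ℓ : Fin p, φ ℓ = false ∧ 1 ≤ ℓ.val := by
  rw [nF, Finset.one_lt_card] at h
  obtain ⟨a, ha, b, hb, hab⟩ := h
  simp only [Finset.mem_filter, Finset.mem_univ, true_and] at ha hb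
  by_cases h0 : 1 ≤ a.val
  · exact ⟨a, ha, h0⟩
  · refine ⟨b, hb, ?_⟩
    by_contra h1
    exact hab (Fin.ext (by omega))

variable {p} in
/-- Flipping at `(ℓ₂ - 1, ℓ₂)` with `φ ℓ₂ = 1`, `ℓ₂ ≥ 1` lowers the descent measure. [folklore] -/
theorem meas_flipAt_lt {φ : Fin p → Bool} {ℓ₂ : Fin p} (hℓ : φ ℓ₂ = false) (h1 : 1 ≤ ℓ₂.val)
    (c : Fin (p - 1)) (hc : c.val + 1 = ℓ₂.val) : meas (flipAt c φ) < meas φ := by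
  have hl1 : lv1 p c = ℓ₂ := Fin.ext (by simp [hc])
  have hl0 : (lv0 p c).val + 1 = ℓ₂.val := by simp [hc]
  have hne : lv0 p c ≠ ℓ₂ := fun h ↦ by have := congrArg Fin.val h; omega
  -- termwise comparison of `meas (flip φ) + (ℓ₂ + 1)` with `meas φ + ℓ₂`
  have key : ∀ ℓ : Fin p,
      (if flipAt c φ ℓ = false then ℓ.val + 1 else 0) + (if ℓ = ℓ₂ then ℓ₂.val + 1 else 0) ≤
        (if φ ℓ = false then ℓ.val + 1 else 0) + (if ℓ = lv0 p c then ℓ₂.val else 0) := by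
    intro ℓ
    by_cases hA : ℓ = ℓ₂
    · subst hA
      have : flipAt c φ ℓ = true := by rw [← hl1, flipAt, setAt_lv1, hl1, hℓ]; rfl
      simp [this, hℓ, hne.symm]
    by_cases hB : ℓ = lv0 p c
    · subst hB
      simp only [hA, if_false, add_zero, if_true]
      split_ifs <;> omega
    · have hfl : flipAt c φ ℓ = φ ℓ :=
        setAt_of_ne c φ _ _ (fun h ↦ hB (Fin.ext h)) (fun h ↦ hA (by rw [← hl1]; exact Fin.ext h))
      simp [hfl, hA, hB]
  have hsum := Finset.sum_le_sum fun ℓ (_ : ℓ ∈ Finset.univ) ↦ key ℓ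
  rw [Finset.sum_add_distrib, Finset.sum_add_distrib, Finset.sum_ite_eq', Finset.sum_ite_eq']
    at hsum
  simp only [Finset.mem_univ, if_true] at hsum
  rw [meas, meas]
  omega

/-- **Descent.** If `d₀ v = 0` and `v` does not vanish at some labelling, then `v` does not
vanish at a labelling with at most one circle labelled `1`: flip at `(ℓ₂ - 1, ℓ₂)` for a level
`ℓ₂ ≥ 1` labelled `1` and induct on the descent measure. [folklore] -/
theorem exists_nF_le_one (hp : 2 ≤ p) (hq : 1 ≤ q) (hpq : p.Coprime q)
    (v : (𝕋).degStates 0 → ℚ) (hv : (𝕋).khovanovD ℚ 0 1 0 (0 + 1) v = 0)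
    (φ₀ : Fin p → Bool) (h0 : v (degZeroEquiv p q hp hq hpq φ₀) ≠ 0) :
    ∃ φ, nF φ ≤ 1 ∧ v (degZeroEquiv p q hp hq hpq φ) ≠ 0 := by
  induction hN : meas φ₀ using Nat.strong_induction_on generalizing φ₀ with
  | _ N ih =>
    by_cases hle : nF φ₀ ≤ 1
    · exact ⟨φ₀, hle, h0⟩
    obtain ⟨ℓ₂, hℓ₂, h1⟩ := exists_false_pos (φ := φ₀) (by omega)
    have hlt := ℓ₂.isLt
    set c : Fin (p - 1) := ⟨ℓ₂.val - 1, by omega⟩ with hc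
    have hrel := ker_flipAt p q hp hq hpq v hv c φ₀
    have h0' : v (degZeroEquiv p q hp hq hpq (flipAt c φ₀)) ≠ 0 := fun h ↦ by
      rw [h, add_zero] at hrel
      exact h0 hrel
    have hm : meas (flipAt c φ₀) < N :=
      hN ▸ meas_flipAt_lt hℓ₂ h1 c (by simp [hc]; omega)
    exact ih _ hm _ h0' rfl

/-- **Quantum degree of a labelling with at most one `1`**: `≤ n - p + 2`. [folklore] -/
theorem qDegree_le_of_nF_le_one (hp : 2 ≤ p) (hq : 1 ≤ q) (hpq : p.Coprime q)
    {φ : Fin p → Bool} (h : nF φ ≤ 1) :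
    qDegree (stateOfFun p q hp hq φ) ≤ ((q * (p - 1) : ℕ) : ℤ) - p + 2 := by
  rw [qDegree_stateOfFun p q hp hq hpq]
  have := nF_add_nT φ
  omega

/-- **Quantum degree of a labelling with at least one `1`**: `≥ n - p + 2`. [folklore] -/
theorem le_qDegree_of_one_le_nF (hp : 2 ≤ p) (hq : 1 ≤ q) (hpq : p.Coprime q)
    {φ : Fin p → Bool} (h : 1 ≤ nF φ) :
    ((q * (p - 1) : ℕ) : ℤ) - p + 2 ≤ qDegree (stateOfFun p q hp hq φ) := by
  rw [qDegree_stateOfFun p q hp hq hpq]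
  have := nF_add_nT φ
  omega

/-- The all-`X` labelling is the only one with no circle labelled `1`. [folklore] -/
theorem one_le_nF_of_ne {φ : Fin p → Bool} (h : φ ≠ fun _ ↦ true) : 1 ≤ nF φ := by
  by_contra h0
  apply h
  funext ℓ
  rw [not_le, Nat.lt_one_iff, nF, Finset.card_eq_zero, Finset.filter_eq_empty_iff] at h0
  simpa using h0 (Finset.mem_univ ℓ)

/-! ## Lower bound: an explicit cycle supported on labellings with a `1` -/

variable {p} in
/-- The sign `(-1)^{#{odd levels labelled X}}`, as a product. [folklore] -/
def sgnOdd (φ : Fin p → Bool) : ℚ := ∏ ℓ, if ℓ.val % 2 = 1 ∧ φ ℓ = true then -1 else 1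

variable {p} in
/-- The sign `(-1)^{#{even levels labelled X}}`, as a product. [folklore] -/
def sgnEven (φ : Fin p → Bool) : ℚ := ∏ ℓ, if ℓ.val % 2 = 0 ∧ φ ℓ = true then -1 else 1

variable {p} in
/-- **The test cycle** `v₀(φ) = ε_odd(φ) ε_odd(X…X) - ε_even(φ) ε_even(X…X)`: a rescaled
difference of Lee's canonical generators `𝔰_o`, `𝔰_ō` written in the basis `{1, X}`, normalised
to vanish on the all-`X` labelling (the bottom of the filtration). Rasmussen (2010), §2.3–2.4,
§5.2. [cite: Rasmussen2010, §5.2] -/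
def v0 (φ : Fin p → Bool) : ℚ :=
  sgnOdd φ * sgnOdd (fun _ : Fin p ↦ true) - sgnEven φ * sgnEven (fun _ : Fin p ↦ true)

variable {p} in
/-- `ε_odd(φ)² = 1`. [folklore] -/
theorem sgnOdd_mul_self (φ : Fin p → Bool) : sgnOdd φ * sgnOdd φ = 1 := by
  rw [sgnOdd, ← Finset.prod_mul_distrib]
  exact Finset.prod_eq_one fun ℓ _ ↦ by split_ifs <;> norm_num

variable {p} in
/-- `ε_even(φ)² = 1`. [folklore] -/
theorem sgnEven_mul_self (φ : Fin p → Bool) : sgnEven φ * sgnEven φ = 1 := by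
  rw [sgnEven, ← Finset.prod_mul_distrib]
  exact Finset.prod_eq_one fun ℓ _ ↦ by split_ifs <;> norm_num

variable {p} in
/-- `v₀` vanishes on the all-`X` labelling. [folklore] -/
theorem v0_allTrue : v0 (fun _ : Fin p ↦ true) = 0 := by
  rw [v0, sgnOdd_mul_self, sgnEven_mul_self, sub_self]

variable {p} in
/-- A product over `Fin p` changes sign when exactly one factor `±1` changes sign. [folklore] -/
theorem prod_eq_neg_prod {f g : Fin p → ℚ} (o : Fin p) (ho : g o = -f o)
    (h : ∀ ℓ, ℓ ≠ o → g ℓ = f ℓ) : ∏ ℓ, g ℓ = -∏ ℓ, f ℓ := by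
  rw [← Finset.mul_prod_erase Finset.univ g (Finset.mem_univ o),
    ← Finset.mul_prod_erase Finset.univ f (Finset.mem_univ o), ho, neg_mul]
  congr 2
  exact Finset.prod_congr rfl fun ℓ hℓ ↦ h ℓ (Finset.ne_of_mem_erase hℓ)

variable {p} in
/-- Flipping at `c`, `c + 1` changes the sign `ε_odd` (exactly one of the two levels is odd).
[folklore] -/
theorem sgnOdd_flipAt (c : Fin (p - 1)) (φ : Fin p → Bool) : sgnOdd (flipAt c φ) = -sgnOdd φ := by
  rw [sgnOdd, sgnOdd]
  rcases Nat.mod_two_eq_zero_or_one c.val with hc | hc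
  · -- `c` even, `c + 1` odd: the changing factor is at `lv1 c`
    refine prod_eq_neg_prod (lv1 p c) ?_ fun ℓ hℓ ↦ ?_
    · have h1 : (lv1 p c).val % 2 = 1 := by simp; omega
      simp only [h1, true_and, flipAt, setAt_lv1]
      cases φ (lv1 p c) <;> simp
    · by_cases h0 : ℓ = lv0 p c
      · subst h0
        have : ¬ (c : ℕ) % 2 = 1 := by omega
        simp [this]
      · rw [flipAt, setAt_of_ne c φ _ _ (fun h ↦ h0 (Fin.ext h)) (fun h ↦ hℓ (Fin.ext h))]
  · -- `c` odd: the changing factor is at `lv0 c`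
    refine prod_eq_neg_prod (lv0 p c) ?_ fun ℓ hℓ ↦ ?_
    · have h1 : (lv0 p c).val % 2 = 1 := by simp; omega
      simp only [h1, true_and, flipAt, setAt_lv0]
      cases φ (lv0 p c) <;> simp
    · by_cases h0 : ℓ = lv1 p c
      · subst h0
        have : ¬ ((c : ℕ) + 1) % 2 = 1 := by omega
        simp [this]
      · rw [flipAt, setAt_of_ne c φ _ _ (fun h ↦ hℓ (Fin.ext h)) (fun h ↦ h0 (Fin.ext h))]

variable {p} in
/-- Flipping at `c`, `c + 1` changes the sign `ε_even`. [folklore] -/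
theorem sgnEven_flipAt (c : Fin (p - 1)) (φ : Fin p → Bool) :
    sgnEven (flipAt c φ) = -sgnEven φ := by
  rw [sgnEven, sgnEven]
  rcases Nat.mod_two_eq_zero_or_one c.val with hc | hc
  · -- `c` even: the changing factor is at `lv0 c`
    refine prod_eq_neg_prod (lv0 p c) ?_ fun ℓ hℓ ↦ ?_
    · have h1 : (lv0 p c).val % 2 = 0 := by simp; omega
      simp only [h1, true_and, flipAt, setAt_lv0]
      cases φ (lv0 p c) <;> simp
    · by_cases h0 : ℓ = lv1 p c
      · subst h0
        have : ¬ ((c : ℕ) + 1) % 2 = 0 := by omega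
        simp [this]
      · rw [flipAt, setAt_of_ne c φ _ _ (fun h ↦ hℓ (Fin.ext h)) (fun h ↦ h0 (Fin.ext h))]
  · -- `c` odd, `c + 1` even: the changing factor is at `lv1 c`
    refine prod_eq_neg_prod (lv1 p c) ?_ fun ℓ hℓ ↦ ?_
    · have h1 : (lv1 p c).val % 2 = 0 := by simp; omega
      simp only [h1, true_and, flipAt, setAt_lv1]
      cases φ (lv1 p c) <;> simp
    · by_cases h0 : ℓ = lv0 p c
      · subst h0
        have : ¬ (c : ℕ) % 2 = 0 := by omega
        simp [this]
      · rw [flipAt, setAt_of_ne c φ _ _ (fun h ↦ h0 (Fin.ext h)) (fun h ↦ hℓ (Fin.ext h))]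

variable {p} in
/-- **`v₀` satisfies the flip relations**: `v₀(flip_c φ) = -v₀(φ)`. [folklore] -/
theorem v0_flipAt (c : Fin (p - 1)) (φ : Fin p → Bool) : v0 (flipAt c φ) = -v0 φ := by
  rw [v0, v0, sgnOdd_flipAt, sgnEven_flipAt]; ring

variable {p} in
/-- `v₀` takes the value `2` on the labelling "`1` on the outermost circle, `X` elsewhere".
[folklore] -/
theorem v0_single (hp : 1 ≤ p) :
    v0 (Function.update (fun _ : Fin p ↦ true) ⟨0, hp⟩ false) = 2 := by
  have hO : sgnOdd (Function.update (fun _ : Fin p ↦ true) ⟨0, hp⟩ false) =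
      sgnOdd (fun _ : Fin p ↦ true) := by
    rw [sgnOdd, sgnOdd]
    refine Finset.prod_congr rfl fun ℓ _ ↦ ?_
    by_cases h : ℓ = ⟨0, hp⟩
    · subst h; simp
    · rw [Function.update_of_ne h]
  have hE : sgnEven (Function.update (fun _ : Fin p ↦ true) ⟨0, hp⟩ false) =
      -sgnEven (fun _ : Fin p ↦ true) := by
    rw [sgnEven, sgnEven]
    refine prod_eq_neg_prod ⟨0, hp⟩ (by simp) fun ℓ hℓ ↦ ?_
    rw [Function.update_of_ne hℓ]
  rw [v0, hO, hE, sgnOdd_mul_self, neg_mul, sgnEven_mul_self]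
  norm_num

variable {p} in
/-- `v₀` is supported on labellings with at least one circle labelled `1`. [folklore] -/
theorem one_le_nF_of_v0_ne_zero {φ : Fin p → Bool} (h : v0 φ ≠ 0) : 1 ≤ nF φ :=
  one_le_nF_of_ne p fun h' ↦ h (by rw [h', v0_allTrue])

/-! ## Every degree-`1` enhanced state is a `stateOne` -/

/-- A state of weight `1` is a one-chord flip of the oriented resolution. [folklore] -/
theorem exists_eq_update_of_homDegree_eq_one {s : (𝕋).EnhancedState} (h : homDegree s = 0 + 1) :
    ∃ i, s.state = Function.update (fun _ ↦ false) i true := by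
  simp only [GaussDiagram.homDegree, nMinus_eq, Nat.cast_zero, sub_zero, zero_add,
    Nat.cast_eq_one, GaussDiagram.State.weight, Finset.card_eq_one] at h
  obtain ⟨i, hi⟩ := h
  refine ⟨i, funext fun j ↦ ?_⟩
  have hj : s.state j = true ↔ j = i := by
    have := Finset.ext_iff.1 hi j
    rw [Finset.mem_filter, Finset.mem_singleton] at this
    exact ⟨fun h ↦ this.1 ⟨Finset.mem_univ _, h⟩, fun h ↦ (this.2 h).2⟩
  by_cases hji : j = i
  · subst hji
    rw [Function.update_self]
    exact hj.2 rfl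
  · rw [Function.update_of_ne hji]
    cases h : s.state j
    · rfl
    · exact absurd (hj.1 h) hji

/-- **Every enhanced state of degree `1` is of the form `stateOne β c λ m`**: its state is the
flip of one chord `(β, c)`, and its labels are constant on the merged circle (levels `c`,
`c + 1`) and on every other level (`circleOf_update_eq_iff`). [folklore] -/
theorem exists_eq_degOne (hp : 2 ≤ p) (hq : 1 ≤ q) (hpq : p.Coprime q)
    (s' : (𝕋).degStates (0 + 1)) :
    ∃ β c lam m, s' = degOne p q hp hq β c lam m := by
  obtain ⟨i, hi⟩ := exists_eq_update_of_homDegree_eq_one p q s'.2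
  rw [← chord_cblk_coff p q i] at hi
  set β := cblk p q i
  set c := coff p q i
  refine ⟨β, c, fun ℓ ↦ s'.1.label ((𝕋).arcOut (lvlPos hp hq ℓ)),
    s'.1.label ((𝕋).arcIn (oPos p q β c)), Subtype.ext (GaussDiagram.EnhancedState.ext' hi ?_)⟩
  funext a
  change s'.1.label a = if lvl p a.val = c ∨ lvl p a.val = c + 1 then _ else _
  have hA : lvl p ((𝕋).arcIn (oPos p q β c)).val = c + 1 := lvl_predPt_oPos β c
  split_ifs with hM
  · apply s'.1.label_eq_of_reachable
    rw [hi, reachable_update_iff p q hpq (n_pos hp hq), hA]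
    exact Or.inr ⟨hM, Or.inr rfl⟩
  · apply s'.1.label_eq_of_reachable
    rw [hi, reachable_update_iff p q hpq (n_pos hp hq)]
    left
    change lvl p a.val = lvl p (lvlPos hp hq (alvl p q hp hq a)).val
    rw [lvl_lvlPos, alvl_val]

/-! ## The test cycle as a Lee cycle, and no boundaries in degree `0` -/

/-- The test vector on degree-`0` enhanced states. [folklore] -/
def z0 (hp : 2 ≤ p) (hq : 1 ≤ q) (hpq : p.Coprime q) : (𝕋).degStates 0 → ℚ :=
  fun s ↦ v0 ((degZeroEquiv p q hp hq hpq).symm s)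

/-- `z₀` on the state of the labelling `φ` is `v₀ φ`. [folklore] -/
@[simp] theorem z0_apply (hp : 2 ≤ p) (hq : 1 ≤ q) (hpq : p.Coprime q) (φ : Fin p → Bool) :
    z0 p q hp hq hpq (degZeroEquiv p q hp hq hpq φ) = v0 φ := by
  simp [z0]

/-- **`z₀` is a Lee cycle**: `d₀ z₀ = 0`, since every degree-`1` state is a `stateOne` and the
two kernel relations are instances of the flip relation `v₀(flip φ) = -v₀(φ)`. [folklore] -/
theorem z0_mem_leeCycles (hp : 2 ≤ p) (hq : 1 ≤ q) (hpq : p.Coprime q) :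
    z0 p q hp hq hpq ∈ (𝕋).leeCycles := by
  rw [GaussDiagram.leeCycles, LinearMap.mem_ker]
  funext s'
  obtain ⟨β, c, lam, m, rfl⟩ := exists_eq_degOne p q hp hq hpq s'
  rw [Pi.zero_apply]
  cases m
  · rw [leeD_degOne_false p q hp hq hpq, z0_apply, z0_apply,
      show setAt c lam true true = flipAt c (setAt c lam false false) by simp [flipAt],
      v0_flipAt, add_neg_cancel]
  · rw [leeD_degOne_true p q hp hq hpq, z0_apply, z0_apply,
      show setAt c lam false true = flipAt c (setAt c lam true false) by simp [flipAt],
      v0_flipAt, add_neg_cancel]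

/-- The Lee cycle `z₀`. [folklore] -/
def Z0 (hp : 2 ≤ p) (hq : 1 ≤ q) (hpq : p.Coprime q) : (𝕋).leeCycles :=
  ⟨z0 p q hp hq hpq, z0_mem_leeCycles p q hp hq hpq⟩

/-- There are no enhanced states of homological degree `-1` (`n₋ = 0`): degree `0` is the
bottom of the complex. Rasmussen (2010), §5.2. [cite: Rasmussen2010, §5.2] -/
theorem isEmpty_degStates_neg_one : IsEmpty ((𝕋).degStates (0 - 1)) :=
  ⟨fun s ↦ by
    have h := s.2
    simp only [GaussDiagram.homDegree, nMinus_eq, Nat.cast_zero, sub_zero] at h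
    omega⟩

/-- **No boundaries in degree `0`**: the projection from Lee cycles to Lee homology is
injective for the torus diagram (the incoming differential has zero domain), so "the only
class homologous to `𝔰_o` is `𝔰_o` itself" (Rasmussen (2010), §5.2). [cite: Rasmussen2010, §5.2] -/
theorem mk_eq_zero_iff (z : (𝕋).leeCycles) :
    (Submodule.Quotient.mk z : (𝕋).LeeHomologyZero) = 0 ↔ z = 0 := by
  rw [Submodule.Quotient.mk_eq_zero, Submodule.mem_comap, LinearMap.mem_range]
  haveI := isEmpty_degStates_neg_one p q
  constructor
  · rintro ⟨y, hy⟩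
    rw [Subsingleton.elim y 0, map_zero] at hy
    exact Subtype.ext hy.symm
  · rintro rfl
    exact ⟨0, by rw [map_zero]; rfl⟩

/-- Injectivity of cycles → homology in degree `0`. [folklore] -/
theorem mk_eq_mk_iff (z z' : (𝕋).leeCycles) :
    (Submodule.Quotient.mk z : (𝕋).LeeHomologyZero) = Submodule.Quotient.mk z' ↔ z = z' := by
  rw [← sub_eq_zero, ← Submodule.Quotient.mk_sub, mk_eq_zero_iff, sub_eq_zero]

/-! ## `s_max = n - p + 2` and `s(T(p,q)) = (p - 1)(q - 1)` -/

/-- **`s_max` of the torus diagram is `n - p + 2`** (`n = q (p - 1)` crossings, `p` circles in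
the oriented resolution). Upper bound: a nonzero class is a nonzero cycle (no boundaries),
which by descent along the flip relations is supported on some labelling with at most one
`1`, of filtration degree `≤ n - p + 2`. Lower bound: the cycle `z₀` is nonzero and supported
on labellings with at least one `1`. This is `s_max = s_min + 2` with
`s_min = q(𝔰_o) = -k + n` of Rasmussen (2010), §5.2 and Prop. 3.3, for this diagram.
[cite: Rasmussen2010, §5.2] -/
theorem leeSMax_torusGauss (hp : 2 ≤ p) (hq : 1 ≤ q) (hpq : p.Coprime q) :
    (𝕋).leeSMax = (((((q * (p - 1) : ℕ) : ℤ) - p + 2 : ℤ) : WithTop ℤ) : WithBot (WithTop ℤ)) := by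
  apply le_antisymm
  · refine iSup₂_le fun α hα ↦ iSup₂_le fun z hz ↦ ?_
    have hz : Submodule.Quotient.mk z = α := hz
    have hz0 : z ≠ 0 := by
      rintro rfl
      exact hα (hz ▸ (mk_eq_zero_iff p q 0).2 rfl)
    have hz1 : z.1 ≠ 0 := fun h ↦ hz0 (Subtype.ext h)
    obtain ⟨φ₀, h0⟩ : ∃ φ₀, z.1 (degZeroEquiv p q hp hq hpq φ₀) ≠ 0 := by
      by_contra h
      push Not at h
      exact hz1 (funext fun s ↦ by simpa using h ((degZeroEquiv p q hp hq hpq).symm s))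
    have hker : (𝕋).khovanovD ℚ 0 1 0 (0 + 1) z.1 = 0 := LinearMap.mem_ker.1 z.2
    obtain ⟨φ, hφ, hne⟩ := exists_nF_le_one p q hp hq hpq z.1 hker φ₀ h0
    refine (iInf₂_le (degZeroEquiv p q hp hq hpq φ) hne).trans ?_
    exact WithBot.coe_le_coe.2 (WithTop.coe_le_coe.2 (qDegree_le_of_nF_le_one p q hp hq hpq hφ))
  · have hz0 : Z0 p q hp hq hpq ≠ 0 := fun h ↦ by
      have h1 := congrArg (fun z : (𝕋).leeCycles ↦ z.1 (degZeroEquiv p q hp hq hpq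
        (Function.update (fun _ : Fin p ↦ true) ⟨0, by omega⟩ false))) h
      simp only [Z0, z0_apply, v0_single (by omega : 1 ≤ p)] at h1
      exact two_ne_zero h1
    refine le_iSup₂_of_le (Submodule.Quotient.mk (Z0 p q hp hq hpq))
      (fun h ↦ hz0 ((mk_eq_zero_iff p q _).1 h)) (le_iSup₂_of_le (Z0 p q hp hq hpq) rfl ?_)
    refine le_iInf₂ fun s hs ↦ ?_
    obtain ⟨φ, rfl⟩ := (degZeroEquiv p q hp hq hpq).surjective s
    have hs : v0 φ ≠ 0 := by simpa [Z0] using hs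
    exact WithBot.coe_le_coe.2 (WithTop.coe_le_coe.2
      (le_qDegree_of_one_le_nF p q hp hq hpq (one_le_nF_of_v0_ne_zero hs)))

/-- **The Rasmussen invariant of the standard diagram of the torus knot `T(p, q)` is
`(p - 1)(q - 1)`**: `s = s_max - 1 = n - p + 1 = q(p-1) - p + 1 = (p-1)(q-1)`
(Rasmussen (2010), §5.2: `s(K) = -k + n + 1` for a positive diagram with `n` crossings and
`k` Seifert circles; Thm. 4 and Cor. 1). [cite: Rasmussen2010, Thm. 4] -/
theorem rasmussenInvariant_torusGauss (hp : 2 ≤ p) (hq : 1 ≤ q) (hpq : p.Coprime q) :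
    (𝕋).rasmussenInvariant = ((p : ℤ) - 1) * ((q : ℤ) - 1) := by
  rw [GaussDiagram.rasmussenInvariant, leeSMax_torusGauss p q hp hq hpq]
  simp only [WithBot.unbotD_coe, WithTop.untopD_coe]
  push_cast [Nat.cast_sub (by omega : 1 ≤ p)]
  ring

end Lee

end TorusGauss

end Literature.Topology.FourManifolds
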